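import Mathlib
import Literature.MathematicalPhysics.QuantumFieldTheory.AnisotropicTwistedPartitionFunctionStrongCoupling
import Literature.MathematicalPhysics.QuantumFieldTheory.YangMillsOS
import HarnessLib

/-!
# Route `MagneticFluxCeiling`, crux `CoulombCeiling` (stmt-QuantumFields-25307): the registered RUNG `stub_strongCouplingCeiling`

The BC3 birth skeleton of the crux (namespace `Summit.QuantumFields.YangMills.Theses.MagneticFluxCeilingBirthK1`, sha `723b4dd7…`)
registers `stub_strongCouplingCeiling : StrongCouplingCeilingP` (critic PRICE P1 «rung before provers», planner RUNG-PLAN-K1.md): for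
`SU(N)`, `N ≥ 2`, `r`, central `z ≠ 1`, there is `β₀ > 0` such that for `0 < β ≤ β₀`: `∃ C L₀, ∀ L ≥ L₀, ∃ K M₀, ∀ M ≥ M₀,
-C·M/L - K ≤ log [Z_z(L³×M)/Z_1(L³×M)]` (`Z = twistedPartitionFunctionAniso r.ρ β L M · (0,1)`).  PROOF: the strong-coupling cluster
expansion on the ANISOTROPIC box (`Literature/…/AnisotropicTwistedPartitionFunctionStrongCoupling.lean`,
`abs_log_twistedPartitionFunctionAniso_sub_le`: `|log Z_z - log Z_1| ≤ 12·L³M·e^{-L²}` for `|β| ≤ 1/(4(N_r+1)·97²e²)`, `L ≥ 1`, EVERY `M` —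
only clusters meeting all `L²` translates of the twisted stack survive, anchored at one of the `6L³M` plaquettes), and the arithmetic
`12·L³M·e^{-L²} ≤ 24·M/L` (`L⁴e^{-L²} ≤ 2`).  Witnesses: `β₀ := 1/(4(N_r+1)·97²e²)`, `C := 24`, `L₀ := 1`, `K := 0`, `M₀ := 0`.
Route-independent imports (Literature only; the statement is spelled over `twistedPartitionFunctionAniso`, same pattern as
`MagneticFluxCeilingCoulombCeilingStubSpectralFloorAtRate.lean`).

HONEST LABEL: the RUNG of LINE g21-A at STRONG coupling only — where the leaf is vacuous (area law ⇒ no perimeter law), as conceded in the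
card; it exercises the lever (zero-temperature flux energy, M-uniform) and says nothing at weak coupling.  `stub_coulombEnergyCeiling`
(all `β`) remains the crux's content; ⟨25307⟩, ⟨25308⟩ stay OPEN; no summit is proved; the Yang–Mills mass gap is NOT proved.
-/

noncomputable section

open MeasureTheory Filter Topology Function

namespace Summit.QuantumFields.YangMills.Theorems.MagneticFluxCeiling

open Literature.MathematicalPhysics.QuantumFieldTheory

/-- The registered stub's statement, letter for letter (birth skeleton of stmt-QuantumFields-25307, stub
`stub_strongCouplingCeiling : StrongCouplingCeilingP`, THE RUNG): at strong coupling `0 < β ≤ β₀(N, r, z)` the log-ratio of the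
`(0,1)`-twisted to the untwisted partition function of the box `L³ × M` is `≥ -C·M/L - K` for `L ≥ L₀`, `M ≥ M₀`. [problem-side] -/
def StrongCouplingCeilingP : Prop :=
  ∀ N : ℕ, 2 ≤ N → ∀ r : Literature.MathematicalPhysics.QuantumFieldTheory.LatticeRep (Matrix.specialUnitaryGroup (Fin N) ℂ), ∀ z : Matrix.specialUnitaryGroup (Fin N) ℂ, z ∈ Subgroup.center (Matrix.specialUnitaryGroup (Fin N) ℂ) → z ≠ 1 → ∃ β₀ : ℝ, 0 < β₀ ∧ ∀ β : ℝ, 0 < β → β ≤ β₀ → ∃ C : ℝ, ∃ L₀ : ℕ, ∀ L : ℕ, L₀ ≤ L → ∃ K : ℝ, ∃ M₀ : ℕ, ∀ M : ℕ, M₀ ≤ M → -C * (M : ℝ) / (L : ℝ) - K ≤ Real.log (Literature.MathematicalPhysics.QuantumFieldTheory.twistedPartitionFunctionAniso r.ρ β L M z ⟨((0 : Fin 4), (1 : Fin 4)), by decide⟩ / Literature.MathematicalPhysics.QuantumFieldTheory.twistedPartitionFunctionAniso r.ρ β L M 1 ⟨((0 : Fin 4), (1 : Fin 4)), by decide⟩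)

/-- `L⁴ e^{-L²} ≤ 2` (from `1 + x + x²/2 ≤ eˣ` at `x = L²`). [problem-side] -/
theorem pow_four_mul_exp_neg_sq_le_two (L : ℝ) : L ^ 4 * Real.exp (-(L ^ 2)) ≤ 2 := by
  have hq := Real.quadratic_le_exp_of_nonneg (sq_nonneg L)
  have hpos : 0 < Real.exp (L ^ 2) := Real.exp_pos _
  rw [Real.exp_neg, ← div_eq_mul_inv, div_le_iff₀ hpos]
  nlinarith [sq_nonneg L]

/-- **THE RUNG `stub_strongCouplingCeiling` BY NAME AND SIGNATURE**: at strong coupling `0 < β ≤ β₀ := 1/(4(N_r+1)·97²e²)`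
(`N_r` = the dimension of the lattice representation `r`), for EVERY `L ≥ 1` and EVERY `M`,
`log [Z_z(L³×M)/Z_1(L³×M)] ≥ -12·L³M·e^{-L²} ≥ -24·M/L` — so `C := 24`, `L₀ := 1`, `K := 0`, `M₀ := 0`.  The `M`-uniformity is
`abs_log_twistedPartitionFunctionAniso_sub_le` (the strong-coupling cluster expansion on the anisotropic box: only clusters meeting
all `L²` translates of the twisted stack survive, anchored at one of the `6L³M` plaquettes).  HONEST LABEL: the rung of LINE g21-A at
strong coupling only, where the leaf is vacuous (area law); `stub_coulombEnergyCeiling` (all `β`) remains the crux's content; no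
summit is proved; the Yang–Mills mass gap is NOT proved. [problem-side] -/
theorem stub_strongCouplingCeiling : StrongCouplingCeilingP := by
  intro N hN r z hz hz1
  refine ⟨1 / (4 * ((r.N : ℝ) + 1) * ((97 : ℝ) ^ 2 * Real.exp 2)), by positivity, fun β hβ hβ₀ => ?_⟩
  refine ⟨24, 1, fun L hL => ⟨0, 0, fun M _ => ?_⟩⟩
  haveI : NeZero L := ⟨by omega⟩
  have hβabs : |β| ≤ 1 / (4 * ((r.N : ℝ) + 1) * ((97 : ℝ) ^ 2 * Real.exp 2)) := by
    rw [abs_of_pos hβ]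
    exact hβ₀
  have h := abs_log_twistedPartitionFunctionAniso_sub_le (Ls := L) (Lt := M) r.ρ r.continuous hβabs hz
  have hZz := twistedPartitionFunctionAniso_pos r.ρ r.continuous β L M z ⟨((0 : Fin 4), (1 : Fin 4)), by decide⟩
  have hZ1 := twistedPartitionFunctionAniso_pos r.ρ r.continuous β L M 1 ⟨((0 : Fin 4), (1 : Fin 4)), by decide⟩
  rw [Real.log_div hZz.ne' hZ1.ne', sub_zero]
  have hlow := (abs_le.1 h).1
  have hL1 : (1 : ℝ) ≤ (L : ℝ) := by exact_mod_cast hL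
  have hLpos : (0 : ℝ) < (L : ℝ) := by linarith
  have hM : (0 : ℝ) ≤ (M : ℝ) := Nat.cast_nonneg M
  have hkey : 12 * ((L : ℝ) ^ 3 * M) * Real.exp (-((L : ℝ) ^ 2)) ≤ 24 * (M : ℝ) / (L : ℝ) := by
    rw [le_div_iff₀ hLpos]
    have h4 := pow_four_mul_exp_neg_sq_le_two (L : ℝ)
    have : 12 * ((L : ℝ) ^ 3 * M) * Real.exp (-((L : ℝ) ^ 2)) * L = 12 * (M : ℝ) * ((L : ℝ) ^ 4 * Real.exp (-((L : ℝ) ^ 2))) := by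
      ring
    rw [this]
    nlinarith
  have h24 : -(24 : ℝ) * (M : ℝ) / (L : ℝ) = -(24 * (M : ℝ) / (L : ℝ)) := by ring
  rw [h24]
  linarith

end Summit.QuantumFields.YangMills.Theorems.MagneticFluxCeiling

end
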